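import Summits.CriticalPhenomena.PercolationContinuityZ3.Theorems.Transplant.KNCells2ChainAdvR
import Summits.CriticalPhenomena.PercolationContinuityZ3.Theorems.Transplant.KNCellsBoxProdZ2RootRun
import Summits.CriticalPhenomena.PercolationContinuityZ3.Theorems.Transplant.BoxProdZ2ConcFaceRegion
import HarnessLib

/-!
# Design (D), `advRoute_of_contact` part 3: the PLANAR INNER RUN of a face-step contact — a rooted straight run (`ChainPlanar.Adv` cores,
# `Adv.regionR` regions) placed at the landing row of the contact's first hop, climbing through the fresh far rows `C.farA x du j`
# (p3-g2, BoxProdZ2ConcFaceRegion) to a face inside `C.M (x + du)`: admissibility and the two planar facts (regions inside `farA`, far face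
# inside `C.M (x + du)`), plus membership in the start row

builds on p205010 (kernel theorem, internal audit signed; external expert review pending) — nothing in this file uses p205010.
Lane `prim-bschramm`, seat `prim-bschramm-p2` (advRoute_of_contact); helper file (`--supports stmt-CriticalPhenomena-4575`).  Pure `Site 2` geometry.

Parameters (signed levels relative to `C.cen x` along `du`): centre `innerCtr C x du ca cb = C.cen x + rootCtr du ca cb` (start row at level
`ca`, transverse offset `cb`), start core = one row (`q = 0`) of half-width `q'`, advance `s₁`, `nA` advance steps, region half-width
`innerρ q' s₁ R' nA = q' + 2s₁ + (nA+3)R'` (the least `AdvOK` allows), region `0` reaching `s₁ + 2R'` below the start row (`Adv.regionR`).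
`InnerRunOK C j s₁ R' ℓ₀ nA ca cb q'`: `0 ≤ q'`, `R' + ℓ₀ ≤ s₁`, `2R' ≤ s₁`, `5r + 10sj + 1 + s₁ + 2R' ≤ ca` (region `0` above the stub of
level `j`), `17r ≤ ca + (nA+1)s₁ ≤ 23r` (far face at the levels of `C.M (x+du)`), `|cb| + q' + 2s₁ + (nA+3)R' ≤ 5r`, `|cb| + q' + s₁ + (nA+2)R' ≤ 3r`.
* `innerRun_advOK`, **`innerRun_regionR_subset_farA`**, **`innerRun_last_subset_M`**, `mem_innerCore_zero`.
[cite: KozmaNitzan2024, §4 Lemma 11 (pp. 22–23), p. 30 (Step III)]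
-/

noncomputable section

namespace Summit.CriticalPhenomena.PercolationContinuityZ3.Theorems

namespace Transplant

namespace BoxProdZ2

open Literature.Probability.Percolation Literature.Probability.LatticeModels
open Literature.Probability.Percolation.KozmaNitzan
open Literature.Probability.Percolation.KozmaNitzan.Cells (oth oth_ne eq_oth_of_ne sgOf sgOf_sign stepVec_apply_fst stepVec_apply_oth)
open ChainPlanar

/-- The centre of the inner run at the macro-vertex `x`: `C.cen x` shifted to signed level `ca` and transverse offset `cb`. [folklore] -/
def innerCtr (C : PCells) (x : Site 2) (du : MDir) (ca cb : ℤ) : Site 2 := C.cen x + rootCtr du ca cb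

/-- The region half-width of the inner run. [folklore] -/
def innerρ (q' s₁ : ℤ) (R' nA : ℕ) : ℤ := q' + 2 * s₁ + ((nA : ℤ) + 3) * R'

/-- **Admissible parameters of the inner run** above the stub of level `j`. [this work] -/
structure InnerRunOK (C : PCells) (j : ℕ) (s₁ : ℤ) (R' ℓ₀ nA : ℕ) (ca cb q' : ℤ) : Prop where
  /-- the start row has a nonnegative half-width -/
  hq' : 0 ≤ q'
  /-- route scales fit in one advance -/
  hs : (R' : ℤ) + ℓ₀ ≤ s₁
  /-- the neighbourhood radius is small -/
  hs2 : 2 * (R' : ℤ) ≤ s₁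
  /-- region `0` stays above the stub of level `j` -/
  hlo : 5 * (C.r : ℤ) + 10 * C.s * j + 1 + s₁ + 2 * R' ≤ ca
  /-- the far face is at least at level `17 r` -/
  hfar1 : 17 * (C.r : ℤ) ≤ ca + ((nA : ℤ) + 1) * s₁
  /-- the far face is at most at level `23 r` -/
  hfar2 : ca + ((nA : ℤ) + 1) * s₁ ≤ 23 * (C.r : ℤ)
  /-- the regions stay inside `farA` transversally -/
  htr : |cb| + q' + 2 * s₁ + ((nA : ℤ) + 3) * R' ≤ 5 * (C.r : ℤ)
  /-- the far face stays inside `C.M (x + du)` transversally -/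
  htrM : |cb| + q' + s₁ + ((nA : ℤ) + 2) * R' ≤ 3 * (C.r : ℤ)

variable {C : PCells} {x : Site 2} {du : MDir} {j : ℕ} {s₁ : ℤ} {R' ℓ₀ nA : ℕ} {ca cb q' : ℤ} (h : InnerRunOK C j s₁ R' ℓ₀ nA ca cb q')
include h

omit h in
/-- The centre along the axis. [folklore] -/
@[simp] theorem innerCtr_fst : innerCtr C x du ca cb du.1 = C.cen x du.1 + sgOf du * ca := by
  simp [innerCtr, rootCtr]

omit h in
/-- The centre across the axis. [folklore] -/
@[simp] theorem innerCtr_oth : innerCtr C x du ca cb (oth du.1) = C.cen x (oth du.1) + cb := by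
  simp [innerCtr, rootCtr, oth_ne]

omit h in
/-- Signed level arithmetic about a shifted centre: `σ (y - (e + σ ca)) = σ (y - e) - ca`. [folklore] -/
theorem sg_mul_sub_add (du : MDir) (y e ca : ℤ) : sgOf du * (y - (e + sgOf du * ca)) = sgOf du * (y - e) - ca := by
  have hσσ : sgOf du * sgOf du = 1 := by rcases sgOf_sign du with h | h <;> simp [h]
  calc sgOf du * (y - (e + sgOf du * ca)) = sgOf du * (y - e) - sgOf du * sgOf du * ca := by ring
    _ = sgOf du * (y - e) - ca := by rw [hσσ, one_mul]

/-- **The inner run is an admissible straight run** (`q = 0`). [cite: KozmaNitzan2024, §4 Lemma 11] -/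
theorem innerRun_advOK : Adv.AdvOK 0 q' s₁ (innerρ q' s₁ R' nA) R' ℓ₀ nA where
  hq := le_rfl
  hq' := h.hq'
  hs := h.hs
  hs2 := h.hs2
  hρ0 := by
    unfold innerρ; have := h.hq'
    have hR0 : (0 : ℤ) ≤ R' := by positivity
    have hN0 : (0 : ℤ) ≤ nA := by positivity
    have hs0 : (0 : ℤ) ≤ s₁ := by linarith [h.hs2]
    have hNR : (0 : ℤ) ≤ (nA : ℤ) * R' := by positivity
    push_cast; nlinarith
  hρ := by unfold innerρ; push_cast; linarith

/-- **Every region of the inner run lies in `farA x du j`** (`k ≤ nA`). [cite: KozmaNitzan2024, §4 Lemma 11 (p. 22: Ω), p. 30] -/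
theorem innerRun_regionR_subset_farA {k : ℕ} (hk : k ≤ nA) :
    Adv.regionR 0 s₁ (innerρ q' s₁ R' nA) R' du.1 (sgOf du) (innerCtr C x du ca cb) k ⊆ C.farA x du j := by
  intro y hy
  have hy' := Adv.regionR_subset_prism (sgOf_sign du) (innerCtr C x du ca cb) (innerRun_advOK h) hk hy
  rw [PCells.mem_psBox_iff] at hy'
  simp only [innerCtr_fst, innerCtr_oth, sg_mul_sub_add, Adv.ρ₀] at hy'
  obtain ⟨⟨hl1, hl2⟩, hb1, hb2⟩ := hy'
  have hlo := h.hlo; have hfar2 := h.hfar2; have htr := h.htr; have hq' := h.hq'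
  have hR0 : (0 : ℤ) ≤ R' := by positivity
  have hN0 : (0 : ℤ) ≤ nA := by positivity
  have hNR : (0 : ℤ) ≤ (nA : ℤ) * R' := by positivity
  unfold innerρ at hb1 hb2
  push_cast at hl1 hl2
  have hcb := le_abs_self cb
  have hcb' := neg_abs_le cb
  have hr1 : (1 : ℤ) ≤ C.r := by exact_mod_cast C.one_le_r
  rw [PCells.farA, PCells.mem_psBox_iff]
  refine ⟨⟨by linarith, by linarith⟩, by linarith, by linarith⟩

/-- **The far face of the inner run lies in `C.M (x + du)`.** [cite: KozmaNitzan2024, §4 p. 26 (M_v), p. 30] -/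
theorem innerRun_last_subset_M :
    Adv.core 0 q' s₁ R' du.1 (sgOf du) (innerCtr C x du ca cb) (nA + 1) ⊆ C.M (x + stepVec du) := by
  intro y hy
  rw [(Adv.core_zero_last (q := (0 : ℤ)) (q' := q') (s₁ := s₁) (R' := R') (N := nA) (a := du.1) (σ := sgOf du)
    (c := innerCtr C x du ca cb)).2, PCells.mem_psBox_iff] at hy
  simp only [innerCtr_fst, innerCtr_oth, sg_mul_sub_add] at hy
  obtain ⟨⟨hl1, hl2⟩, hb1, hb2⟩ := hy
  have hfar1 := h.hfar1; have hfar2 := h.hfar2; have htrM := h.htrM; have hq' := h.hq'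
  have hR0 : (0 : ℤ) ≤ R' := by positivity
  unfold Adv.w₁ at hb1 hb2
  push_cast at hl1 hl2 hb1 hb2
  have hcb := le_abs_self cb
  have hcb' := neg_abs_le cb
  rw [PCells.M, PCells.mem_sq_iff]
  intro i
  by_cases hi : i = du.1
  · subst hi
    rw [PCells.cen_add_stepVec_fst]
    push_cast
    rcases sgOf_sign du with hs | hs
    · rw [hs] at hl1 hl2
      simp only [one_mul] at hl1 hl2
      rw [hs]; constructor <;> linarith
    · rw [hs] at hl1 hl2
      rw [hs]; constructor <;> linarith
  · rw [eq_oth_of_ne hi, PCells.cen_add_stepVec_oth]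
    push_cast
    constructor <;> linarith

omit h in
/-- **Membership in the start row** `core 0 = {level = ca, |trans - (cen_b + cb)| ≤ q'}` (for the landing piece of the first hop). [folklore] -/
theorem mem_innerCore_zero {y : Site 2} :
    y ∈ Adv.core 0 q' s₁ R' du.1 (sgOf du) (innerCtr C x du ca cb) 0 ↔
      sgOf du * (y du.1 - C.cen x du.1) = ca ∧ C.cen x (oth du.1) + cb - q' ≤ y (oth du.1) ∧ y (oth du.1) ≤ C.cen x (oth du.1) + cb + q' := by
  rw [(Adv.core_zero_last (q := (0 : ℤ)) (q' := q') (s₁ := s₁) (R' := R') (N := 0) (a := du.1) (σ := sgOf du)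
    (c := innerCtr C x du ca cb)).1, PCells.mem_psBox_iff]
  simp only [innerCtr_fst, innerCtr_oth, sg_mul_sub_add, neg_zero]
  constructor
  · rintro ⟨⟨h1, h2⟩, h3, h4⟩; exact ⟨by linarith, h3, h4⟩
  · rintro ⟨h1, h3, h4⟩; exact ⟨⟨by linarith, by linarith⟩, h3, h4⟩

end BoxProdZ2

end Transplant

end Summit.CriticalPhenomena.PercolationContinuityZ3.Theorems

end
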